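import Summits.ResolutionOfSingularities.ResolutionOfSingularities.Theorems.FreezeCutLaw
import HarnessLib

/-!
# FreezeCutHalf — decomp-res node «FreezeCut» (lens-3 g19 rev 2, critic rows 149/149a/149b), tree file 3/5 of the node

Content VERBATIM from the decomp-res lens-3 g19 TREE-FACING COMPANION
`HOME/decomp-res-lens-3/g19/tree/FreezeCutTree.lean` (rev 3 pin
7e31fb5a…; = node `FreezeCut.lean` rev 2 pin c7927053 NEW PART ONLY; HOME = run/shared/lean/pub/decomp-res).
Critic: CRITIC-LEDGER rows 149 / 149a /
149b CLEARED (orders 2026-08-30T22:14:37Z / 22:25:58Z / 22:27:55Z).  Landed by decomp-res writer g8 as five files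
— `FreezeCutConeVars` (§V),
`FreezeCutLaw` (§F), `FreezeCutHalf` (§H) [namespace `…Theorems.HoleCut`, in-cone behind
`MaxContactCutHoleCut`], `FreezeCutClasses` (cone-free
classes of §K5/§K6; carries the full landing note and the companion description) and the wiring file
`MaxContactCutFreezeCut` — all
`--supports stmt-ResolutionOfSingularities-31770`.

§H THE HALF-CRITICAL FREEZING LAW (g19 rev 2, window (β″)): `2n ≤ q` suffices — NO JOINT TAILS OF LOW SHADE
(potential form of the
freezing law).  PROVED, 0 sorry.  Imports `FreezeCutLaw`.

[WRITER NOTE (decomp-res writer g8): section split only; namespaces, opens, section variables and every declaration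
exactly as in the
companion (its global `linter.dupNamespace` option line dropped).]

(Sources: Hauser2010; Moh1987; CossartPiltant2008I; BenitoVillamayor2012; KawanoueMatsuki2010; HironakaBowdoin2005.)
-/

noncomputable section

open MvPolynomial Finset
open Literature.AlgebraicGeometry.Resolution
open Literature.AlgebraicGeometry.Resolution.Hauser2010
open Literature.AlgebraicGeometry.Resolution.PointBlowup
open Summit.ResolutionOfSingularities.ResolutionOfSingularities.Theses
open Summit.ResolutionOfSingularities.ResolutionOfSingularities.Theorems.TightDefectClasses
open Summit.ResolutionOfSingularities.ResolutionOfSingularities.Theorems.TightDefectStrongWalks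
open Summit.ResolutionOfSingularities.ResolutionOfSingularities.Theorems.ItineraryCutClasses
open Summit.ResolutionOfSingularities.ResolutionOfSingularities.Theorems.BoundaryLedger
open Summit.ResolutionOfSingularities.ResolutionOfSingularities.Theorems.ProximityCut
open Summit.ResolutionOfSingularities.ResolutionOfSingularities.Theorems.ConeCutAxisLaw
open Literature.AlgebraicGeometry.Resolution.WeightedBlowup
open Literature.Barriers.ResolutionOfSingularities
open Summit.ResolutionOfSingularities.ResolutionOfSingularities.Theorems.FloorCut
open Summit.ResolutionOfSingularities.ResolutionOfSingularities.Theorems.ConeCut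
open Summit.ResolutionOfSingularities.ResolutionOfSingularities.Theorems.ExitLaw (fin3_cases eq_of_le_of_degree_le)
open Summit.ResolutionOfSingularities.ResolutionOfSingularities.Theorems.ShadeCut
open Summit.ResolutionOfSingularities.ResolutionOfSingularities.Theorems.TightCut
open Summit.ResolutionOfSingularities.ResolutionOfSingularities.Theorems.HoleCut

namespace Summit.ResolutionOfSingularities.ResolutionOfSingularities.Theorems.HoleCut

/-! ## §H THE HALF-CRITICAL FREEZING LAW (g19 rev 2) — `2n ≤ q` suffices: NO JOINT TAILS OF LOW SHADE

(F3) was the only place `3n ≤ q + 2` entered.  Replace its one-move ledger bound by a POTENTIAL: behind a dead support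
every stage is poor; after ONE proximity repeat all three boundary multiplicities are `≤ n − 1` (SMALL), smallness
persists (H1), and at a small stage with a dead support the boundary mass DROPS at every move (H2: the dead support
contributes `0` — if it is the chart it must be translated (V1), which kills another coordinate —, the chart receives
the newest mass `D + n − q`, and at most one old coordinate `≤ n − 1` survives: `D' ≤ D + 2n − 1 − q ≤
D − 1` iff
`2n ≤ q`).  The mass is bounded below by the excess floor `q + 1 − n`: contradiction (H3 = F3 at `2n ≤ q`).  Then F4,
the freezing law and «no joint tails» go through VERBATIM with `2n ≤ q` (primed names). -/

section HalfCritical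

variable {K : Type} [Field K] [DecidableEq K] {q : ℕ} {s₀ : State (Fin 3) K}

namespace TailShade

variable {W : ForcedWalk q s₀} {N n : ℕ}

/-- (H1) SMALLNESS PERSISTS behind poverty: if every `r_v(y) ≤ n − 1` at a poor tail stage, the same holds at
`v + 1`. [new] [folklore] -/
theorem small_succ (hroot : IsRoot q s₀) (h : TailShade W N n) (v : ℕ) (hv : N ≤ v) (hz : HasZero W v)
    (hs : ∀ y, (W.st v).r y + 1 ≤ n) : ∀ y, (W.st (v + 1)).r y + 1 ≤ n := by
  obtain ⟨-, hnew, hkeep⟩ := h.step hroot v hv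
  have hD := degree_lt_of_hasZero hroot W v hz
  intro y
  by_cases hy : y = W.j v
  · rw [hy]; omega
  · rw [hkeep y hy]
    have h1 := kept_le W v y
    have h2 := hs y
    omega

/-- (H2) THE MASS LEDGER at a small stage carrying a dead support: `D_{v+1} + q + 1 ≤ D_v + 2n` — so the mass
DROPS when `2n ≤ q`. [new] [folklore] -/
theorem degree_drop (hroot : IsRoot q s₀) (h : TailShade W N n) (v : ℕ) (hv : N ≤ v)
    (hd : ∃ x, DeadSupport W v x) (hs : ∀ y, (W.st v).r y + 1 ≤ n) :
    (W.st (v + 1)).r.degree + q + 1 ≤ (W.st v).r.degree + 2 * n := by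
  classical
  obtain ⟨x, hcx, hrx⟩ := hd
  obtain ⟨-, hnew, hkeep⟩ := h.step hroot v hv
  obtain ⟨o, ho, hqo, hplat, hn, -⟩ := h.stage hroot v hv
  -- a coordinate `z ≠ j_v` whose new multiplicity vanishes
  obtain ⟨z, hzj, hz0⟩ : ∃ z, z ≠ W.j v ∧ (W.st (v + 1)).r z = 0 := by
    by_cases hxj : x = W.j v
    · -- the chart is the dead support: the move is translated (V1), and the translated coordinate dies
      have hb : W.b v ≠ 0 := by
        intro hb
        refine not_coneVar_chart_of_untranslated hroot W v ho hqo hplat hn hb ?_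
        rw [← hxj]
        exact hcx
      obtain ⟨z, hbz⟩ : ∃ z, W.b v z ≠ 0 := by
        by_contra hall
        push Not at hall
        exact hb (funext fun l => hall l)
      have hzj : z ≠ W.j v := by
        intro h'
        rw [h'] at hbz
        exact hbz (W.onExc v)
      exact ⟨z, hzj, by rw [hkeep z hzj, kept_of_ne W v hzj, if_neg hbz]⟩
    · refine ⟨x, hxj, ?_⟩
      rw [hkeep x hxj]
      have := kept_le W v x
      omega
  obtain ⟨y, hyj, hyz⟩ := exists_third hzj.symm
  have hy1 : (W.st (v + 1)).r y ≤ (W.st v).r y := by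
    rw [hkeep y hyj]
    exact kept_le W v y
  have hsy := hs y
  rw [degree_eq_three (W.st (v + 1)).r hzj.symm hyj hyz]
  omega

/-- **(H3) = (F3) AT `2n ≤ q`: NO PROXIMITY REPEAT BEHIND A DEAD SUPPORT (PROVED by the mass potential).** [new] [folklore] -/
theorem not_stays_of_dead' (hroot : IsRoot q s₀) (hq : 2 * n ≤ q) (hn1 : 1 ≤ n) (h : TailShade W N n) (t : ℕ)
    (ht : N ≤ t) (hz0 : HasZero W t) (hd1 : ∃ x, DeadSupport W (t + 1) x) : ¬ StaysOnNewest W t := by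
  classical
  rintro ⟨hne, hbn⟩
  -- dead supports, hence poverty, at every stage `≥ t + 1`
  have hdead : ∀ d, ∃ x, DeadSupport W (t + 1 + d) x := by
    intro d
    induction d with
    | zero => exact hd1
    | succ d ih =>
      rw [show t + 1 + (d + 1) = t + 1 + d + 1 by omega]
      exact h.dead_succ hroot hn1 (t + 1 + d) (by omega) ih
  have hzero : ∀ d, HasZero W (t + 1 + d) := fun d => by
    obtain ⟨x, -, hrx⟩ := hdead d
    exact ⟨x, hrx⟩
  -- stage `t + 2` is SMALL: newest masses `δ_{t+1}`, `δ_t`, and the third coordinate `0` (as in F3)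
  obtain ⟨x, hcx, hrx⟩ := hd1
  have hD0 := degree_lt_of_hasZero hroot W t hz0
  have hD1 := degree_lt_of_hasZero hroot W (t + 1) ⟨x, hrx⟩
  obtain ⟨-, hnew0, -⟩ := h.step hroot t ht
  obtain ⟨-, hnew1, hkeep1⟩ := h.step hroot (t + 1) (by omega)
  have hw0 := h.degree_window hroot t ht
  have hxj : x ≠ W.j t := by
    intro h'
    rw [h'] at hrx
    omega
  obtain ⟨m, hmn, hmc⟩ := exists_third hne.symm
  obtain ⟨-, hkm⟩ := TailThree.kept_three W t hne hmn hmc hbn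
  have hkm0 : kept W (t + 1) m = 0 := by
    by_cases hcx' : W.j (t + 1) = x
    · by_cases hb : W.b (t + 1) = 0
      · exfalso
        obtain ⟨o, ho, hqo, hplat, hn, -⟩ := h.stage hroot (t + 1) (by omega)
        refine not_coneVar_chart_of_untranslated hroot W (t + 1) ho hqo hplat hn hb ?_
        rw [hcx']
        exact hcx
      · have hbm : W.b (t + 1) m ≠ 0 := by
          intro hbm
          apply hb
          funext l
          rcases fin3_cases hne.symm hmn hmc l with hl | hl | hl <;> rw [hl]
          · exact hbn
          · exact W.onExc (t + 1)
          · exact hbm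
        rw [hkm, if_neg hbm]
    · have hxm : x = m := by
        rcases fin3_cases hne.symm hmn hmc x with hl | hl | hl
        · exact absurd hl hxj
        · exact absurd hl.symm hcx'
        · exact hl
      rw [hkm]
      split_ifs
      · rw [← hxm]; exact hrx
      · rfl
  have hjt : (W.st (t + 2)).r (W.j t) = (W.st (t + 1)).r (W.j t) := by
    rw [show t + 2 = t + 1 + 1 from rfl, hkeep1 (W.j t) hne.symm, kept_of_ne W (t + 1) hne.symm, if_pos hbn]
  have hmt : (W.st (t + 2)).r m = 0 := by
    rw [show t + 2 = t + 1 + 1 from rfl, hkeep1 m hmc, hkm0]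
  have hsmall2 : ∀ y, (W.st (t + 2)).r y + 1 ≤ n := by
    intro y
    rcases fin3_cases hne.symm hmn hmc y with hl | hl | hl <;> rw [hl]
    · rw [hjt]; omega
    · rw [show t + 2 = t + 1 + 1 from rfl]; omega
    · rw [hmt]; omega
  -- the potential: smallness persists and the mass drops by one at every later move
  have hpot : ∀ d, (∀ y, (W.st (t + 2 + d)).r y + 1 ≤ n) ∧ (W.st (t + 2 + d)).r.degree + d ≤ (W.st (t + 2)).r.degree := by
    intro d
    induction d with
    | zero => exact ⟨fun y => by simpa using hsmall2 y, by simp⟩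
    | succ d ih =>
      have hz : HasZero W (t + 2 + d) := by
        have := hzero (d + 1)
        rwa [show t + 1 + (d + 1) = t + 2 + d by omega] at this
      have hdd : ∃ x, DeadSupport W (t + 2 + d) x := by
        have := hdead (d + 1)
        rwa [show t + 1 + (d + 1) = t + 2 + d by omega] at this
      have hdrop := h.degree_drop hroot (t + 2 + d) (by omega) hdd ih.1
      refine ⟨?_, ?_⟩
      · rw [show t + 2 + (d + 1) = t + 2 + d + 1 by omega]
        exact h.small_succ hroot (t + 2 + d) (by omega) hz ih.1
      · rw [show t + 2 + (d + 1) = t + 2 + d + 1 by omega]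
        have := ih.2
        omega
  -- run the potential down to the excess floor
  obtain ⟨-, hfin⟩ := hpot ((W.st (t + 2)).r.degree)
  have hw := h.degree_window hroot (t + 2 + (W.st (t + 2)).r.degree) (by omega)
  omega

/-- (F4) at `2n ≤ q`: two cone variables kill a joint tail. [new] [folklore] -/
theorem no_twoConeVars' (hroot : IsRoot q s₀) (hq : 2 * n ≤ q) (hn1 : 1 ≤ n) (h : TailShade W N n)
    (hrep : ∀ M, ∃ t, M ≤ t ∧ StaysOnNewest W t) (htr : ∀ M, ∃ t, M ≤ t ∧ W.b t ≠ 0)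
    {t₀ : ℕ} (ht₀ : N ≤ t₀) (htwo : TwoConeVars W t₀) : False := by
  classical
  have hJ : ∀ t, t₀ ≤ t → TwoConeVars W t ∨ ∃ x, DeadSupport W t x := by
    intro t ht
    induction t, ht using Nat.le_induction with
    | base => exact Or.inl htwo
    | succ t ht ih => exact h.twoOrDead_succ hroot hn1 t (by omega) ih
  obtain ⟨t₁, ht₁, hb⟩ := htr t₀
  have hD : ∀ d, ∃ x, DeadSupport W (t₁ + 1 + d) x := by
    intro d
    induction d with
    | zero => exact h.dead_succ_of_translated hroot hn1 t₁ (by omega) (hJ t₁ ht₁) hb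
    | succ d ih =>
      rw [show t₁ + 1 + (d + 1) = t₁ + 1 + d + 1 by omega]
      exact h.dead_succ hroot hn1 (t₁ + 1 + d) (by omega) ih
  obtain ⟨u, hu, hS⟩ := hrep (t₁ + 1)
  obtain ⟨d, rfl⟩ : ∃ d, u = t₁ + 1 + d := ⟨u - (t₁ + 1), by omega⟩
  obtain ⟨x, -, hrx⟩ := hD d
  have hd1 := hD (d + 1)
  rw [show t₁ + 1 + (d + 1) = t₁ + 1 + d + 1 by omega] at hd1
  exact h.not_stays_of_dead' hroot hq hn1 (t₁ + 1 + d) (by omega) ⟨x, hrx⟩ hd1 hS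

/-- **THE HALF-CRITICAL FREEZING LAW (PROVED)**: on a joint tail of shade `n ≥ 1`, positive excess, `q ≥ 2n`, one
coordinate is THE unique cone variable from `N` on, never charted, never translated. [new] [folklore] -/
theorem frozen_of_joint' (hroot : IsRoot q s₀) (hq : 2 * n ≤ q) (hn1 : 1 ≤ n) (h : TailShade W N n)
    (hrep : ∀ M, ∃ t, M ≤ t ∧ StaysOnNewest W t) (htr : ∀ M, ∃ t, M ≤ t ∧ W.b t ≠ 0) :
    ∃ k : Fin 3, ∀ t, N ≤ t → ConeVar W t k ∧ (∀ x, ConeVar W t x → x = k) ∧ W.j t ≠ k ∧ W.b t k = 0 := by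
  classical
  have hone : ∀ t, N ≤ t → ∀ x y, ConeVar W t x → ConeVar W t y → x = y := by
    intro t ht x y hx hy
    by_contra hxy
    exact h.no_twoConeVars' hroot hq hn1 hrep htr ht ⟨x, y, hxy, hx, hy⟩
  obtain ⟨o, ho, hqo, hplat, hn, -⟩ := h.stage hroot N le_rfl
  obtain ⟨k, -, hck⟩ := exists_coneVar_ne_chart hroot W N ho hqo hplat hn hn1
  refine ⟨k, ?_⟩
  have hall : ∀ t, N ≤ t → ConeVar W t k := by
    intro t ht
    induction t, ht using Nat.le_induction with
    | base => exact hck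
    | succ t ht ih =>
      obtain ⟨o, ho, hqo, hplat, hn, -⟩ := h.stage hroot t ht
      obtain ⟨x, hxj, hcx⟩ := exists_coneVar_ne_chart hroot W t ho hqo hplat hn hn1
      have hxk : x = k := hone t ht x k hcx ih
      rw [hxk] at hxj
      exact coneVar_succ hroot W t ho hqo hplat hn hxj ih
  intro t ht
  obtain ⟨o, ho, hqo, hplat, hn, -⟩ := h.stage hroot t ht
  obtain ⟨x, hxj, hcx⟩ := exists_coneVar_ne_chart hroot W t ho hqo hplat hn hn1
  have hxk : x = k := hone t ht x k hcx (hall t ht)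
  rw [hxk] at hxj
  exact ⟨hall t ht, fun y hy => hone t ht y k hy (hall t ht), fun h' => hxj h'.symm,
    b_eq_zero_of_coneVar_subset hroot W t ho hqo hplat hn hn1 hxj fun y hy => hone t ht y k hy (hall t ht)⟩

/-- A half-supercritical joint tail is PLANAR (lens-5's letter). [new] [folklore] -/
theorem planar_of_joint' (hroot : IsRoot q s₀) (hq : 2 * n ≤ q) (hn1 : 1 ≤ n) (h : TailShade W N n)
    (hrep : ∀ M, ∃ t, M ≤ t ∧ StaysOnNewest W t) (htr : ∀ M, ∃ t, M ≤ t ∧ W.b t ≠ 0) :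
    ∃ k : Fin 3, ∀ t, N ≤ t → W.j t ≠ k ∧ W.b t k = 0 := by
  obtain ⟨k, hk⟩ := h.frozen_of_joint' hroot hq hn1 hrep htr
  exact ⟨k, fun t ht => ⟨(hk t ht).2.2.1, (hk t ht).2.2.2⟩⟩

/-- **THERE ARE NO JOINT TAILS WITH `2n ≤ q` (PROVED, hypothesis-free, every shade at once).** [new] [folklore] -/
theorem no_joint' (hroot : IsRoot q s₀) (hq : 2 * n ≤ q) (hn1 : 1 ≤ n) (h : TailShade W N n)
    (hrep : ∀ M, ∃ t, M ≤ t ∧ StaysOnNewest W t) (htr : ∀ M, ∃ t, M ≤ t ∧ W.b t ≠ 0) : False := by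
  classical
  obtain ⟨k, hk⟩ := h.frozen_of_joint' hroot hq hn1 hrep htr
  have hP : PlanarCut.PlanarFrom W k N := fun t ht => ⟨(hk t ht).2.2.1, (hk t ht).2.2.2⟩
  by_cases hr : 1 ≤ (W.st N).r k
  · exact PlanarCut.noPlanarTails hroot W k N hP hr hrep htr
  · have hz : ∀ t, N ≤ t → (W.st t).r k = 0 := by
      intro t ht
      induction t, ht using Nat.le_induction with
      | base => omega
      | succ t ht ih =>
        obtain ⟨-, -, hkeep⟩ := h.step hroot t ht
        rw [hkeep k (hk t ht).2.2.1.symm, kept_of_ne W t (hk t ht).2.2.1.symm, if_pos (hk t ht).2.2.2]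
        exact ih
    obtain ⟨t, ht, hS⟩ := hrep N
    exact h.not_stays_of_dead' hroot hq hn1 t ht ⟨k, hz t ht⟩ ⟨k, (hk (t + 1) (by omega)).1, hz (t + 1) (by omega)⟩ hS

end TailShade

end HalfCritical

end Summit.ResolutionOfSingularities.ResolutionOfSingularities.Theorems.HoleCut
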